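import Literature.Computability.AlgebraicComplexity.LocalStrongUSP

/-!
# `RectangularThmB` (crux stmt-MatrixMultiplication-10597, route ThinBlockAlpha):
# skew local strong USP families of maximum size (negative-side combinatorics)

Negative-side support file of the crux disprover (cdisprove seat); `sorry`-free.  Skew LOCAL STRONG
USPs (Cohn–Kleinberg–Szegedy–Umans 2005 §6.1, tree `IsLocalStrongUSP`) in the composition class
`(n,1,n)` (width `k = 2n+1`, one `2` per row): the unique-pieces cap is `|U| ≤ C(k,1) = k`, and it
is ATTAINED —

* `cyc11` / `cyc11_isLocalStrongUSP` / `cyc11_counts` — the 11 cyclic shifts of `21113133133`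
  (`k = 11`, found by search; the maximum at `k = 7` is only 4), checked by `decide`;
* `cycRow n` / `cycRow_isLocalStrongUSP` (`n ≥ 5`) — THE INFINITE FAMILY: the `2n+1` cyclic shifts
  of `2 1^{n-2} 3 1 3 3 1 3^{n-3}`.  Proof: a row has a single `2`, so the ordered triple `(u,v,w)`
  is separated iff the `1`-set of `u` meets the `3`-set of `w` twice (one hit avoids the `2` of
  `v`), i.e. iff `|O \ ((O+δ) ∪ {δ})| ≥ 2` for the `1`-set `O = [1,n-2] ∪ {n,n+3}` and every shift
  `δ ≠ 0` — `cyc_witness` gives explicit witnesses, `omega` checks them;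
* `card_cycRow_zero/one/two` — every row has `n` ones, one two, `n` threes.

Through CKSU Thm 33 these are bounded-exponent thin STPP designs; the consequences for the crux
(`not_uniform_half_a`, `not_uniform_linear_eta`) are in `NoUniformEta.lean`.  Details:
`Cruxes/RectangularThmB/Disproof.lean`.
-/

namespace Summit.MatrixMultiplication.MatrixMultiplication.Theorems.RectangularThmB.Negative

open Literature.Computability.AlgebraicComplexity

/-! ## Width 11 by `decide` -/

/-- The 11 cyclic shifts of the word `21113133133` (symbols `1,2,3` coded `0,1,2`), row `j` having
its `2` at position `j`: a skew local strong USP of the composition class `(5,1,5)`. -/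
def cyc11 : Fin 11 → Fin 11 → Fin 3 :=
  ![![1, 0, 0, 0, 2, 0, 2, 2, 0, 2, 2],
    ![2, 1, 0, 0, 0, 2, 0, 2, 2, 0, 2],
    ![2, 2, 1, 0, 0, 0, 2, 0, 2, 2, 0],
    ![0, 2, 2, 1, 0, 0, 0, 2, 0, 2, 2],
    ![2, 0, 2, 2, 1, 0, 0, 0, 2, 0, 2],
    ![2, 2, 0, 2, 2, 1, 0, 0, 0, 2, 0],
    ![0, 2, 2, 0, 2, 2, 1, 0, 0, 0, 2],
    ![2, 0, 2, 2, 0, 2, 2, 1, 0, 0, 0],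
    ![0, 2, 0, 2, 2, 0, 2, 2, 1, 0, 0],
    ![0, 0, 2, 0, 2, 2, 0, 2, 2, 1, 0],
    ![0, 0, 0, 2, 0, 2, 2, 0, 2, 2, 1]]

/-- `cyc11` is a local strong USP (CKSU §6.1), by exhaustive check of the `11³` ordered triples. -/
theorem cyc11_isLocalStrongUSP : IsLocalStrongUSP cyc11 := by
  unfold IsLocalStrongUSP cyc11 localStrongUSPPatterns
  decide

/-- Every row of `cyc11` has exactly five `1`s, one `2` (and five `3`s). -/
theorem cyc11_counts (a : Fin 11) :
    (Finset.univ.filter fun j => cyc11 a j = 0).card = 5 ∧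
      (Finset.univ.filter fun j => cyc11 a j = 1).card = 1 ∧
      (Finset.univ.filter fun j => cyc11 a j = 2).card = 5 := by
  revert a; unfold cyc11; decide

/-! ## The infinite cyclic family -/


/-- Membership (by value) in the `1`-set `O = [1, n-2] ∪ {n, n+3}` of the base word
`2 1^{n-2} 3 1 3 3 1 3^{n-3}`. -/
def inO (n x : ℕ) : Prop := (1 ≤ x ∧ x ≤ n - 2) ∨ x = n ∨ x = n + 3

/-- `inO` is decidable. -/
instance (n x : ℕ) : Decidable (inO n x) := by unfold inO; infer_instance

/-- The cyclic family: row `α` has its `2` (coded `1`) at `α`, `1`s (coded `0`) on `α + O`, and `3`s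
(coded `2`) elsewhere — the `2n+1` cyclic shifts of `2 1^{n-2} 3 1 3 3 1 3^{n-3}`. -/
def cycRow (n : ℕ) (α t : Fin (2 * n + 1)) : Fin 3 :=
  if t = α then 1 else if inO n (t - α).val then 0 else 2

/-- Value of a difference in `Fin k`, without `%`. -/
theorem val_sub_eq {k : ℕ} (a b : Fin k) :
    ((a - b : Fin k) : ℕ) = if b ≤ a then (a : ℕ) - b else k + a - b := by
  split_ifs with h
  · exact Fin.coe_sub_iff_le.mpr h
  · exact Fin.coe_sub_iff_lt.mpr (not_le.mp h)

/-- The combinatorial heart: for every nonzero shift `δ` there are two distinct `o₁, o₂ ∈ O`, both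
`≠ δ`, with `oᵢ - δ ∉ O` (i.e. `|O \ ((O+δ) ∪ {δ})| ≥ 2`).  Witnesses are explicit and piecewise
in `δ`; each case is linear arithmetic. -/
theorem cyc_witness {n : ℕ} (hn : 5 ≤ n) (δ : Fin (2 * n + 1)) (hδ : δ ≠ 0) :
    ∃ o₁ o₂ : Fin (2 * n + 1), o₁ ≠ o₂ ∧ inO n o₁.val ∧ inO n o₂.val ∧ o₁ ≠ δ ∧ o₂ ≠ δ ∧
      ¬ inO n (o₁ - δ).val ∧ ¬ inO n (o₂ - δ).val := by
  have hd0 : δ.val ≠ 0 := fun h => hδ (Fin.ext (by rw [h]; rfl))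
  have hdk : δ.val < 2 * n + 1 := δ.isLt
  -- a uniform way to discharge a case with numeric witnesses v, w
  have mk : ∀ v w : ℕ, ∀ (hv : v < 2 * n + 1) (hw : w < 2 * n + 1), v ≠ w → inO n v → inO n w →
      v ≠ δ.val → w ≠ δ.val →
      ¬ inO n (if δ.val ≤ v then v - δ.val else 2 * n + 1 + v - δ.val) →
      ¬ inO n (if δ.val ≤ w then w - δ.val else 2 * n + 1 + w - δ.val) →
      ∃ o₁ o₂ : Fin (2 * n + 1), o₁ ≠ o₂ ∧ inO n o₁.val ∧ inO n o₂.val ∧ o₁ ≠ δ ∧ o₂ ≠ δ ∧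
        ¬ inO n (o₁ - δ).val ∧ ¬ inO n (o₂ - δ).val := by
    intro v w hv hw hvw hv1 hw1 hvd hwd hv2 hw2
    refine ⟨⟨v, hv⟩, ⟨w, hw⟩, ?_, hv1, hw1, ?_, ?_, ?_, ?_⟩
    · intro e; exact hvw (congrArg Fin.val e)
    · intro e; exact hvd (congrArg Fin.val e)
    · intro e; exact hwd (congrArg Fin.val e)
    · rw [val_sub_eq]; simp only [Fin.le_def]; exact hv2
    · rw [val_sub_eq]; simp only [Fin.le_def]; exact hw2
  set d := δ.val with hd
  -- case analysis on d
  rcases Nat.lt_or_ge d 3 with h3 | h3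
  · rcases Nat.lt_or_ge d 2 with h2 | h2
    · -- d = 1 : (n, n+3)
      apply mk n (n + 3) (by omega) (by omega) (by omega) (by unfold inO; omega)
        (by unfold inO; omega) (by omega) (by omega) <;>
      · unfold inO; split_ifs <;> omega
    · -- d = 2 : (1, n+3)
      apply mk 1 (n + 3) (by omega) (by omega) (by omega) (by unfold inO; omega)
        (by unfold inO; omega) (by omega) (by omega) <;>
      · unfold inO; split_ifs <;> omega
  rcases Nat.lt_or_ge d (n - 1) with h4 | h4
  · -- 3 ≤ d ≤ n-2 : (1, 2)
    apply mk 1 2 (by omega) (by omega) (by omega) (by unfold inO; omega)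
      (by unfold inO; omega) (by omega) (by omega) <;>
    · unfold inO; split_ifs <;> omega
  rcases Nat.lt_or_ge d (n + 4) with h5 | h5
  · -- middle: d ∈ [n-1, n+3]
    have : d = n - 1 ∨ d = n ∨ d = n + 1 ∨ d = n + 2 ∨ d = n + 3 := by omega
    rcases this with e | e | e | e | e
    · apply mk 2 3 (by omega) (by omega) (by omega) (by unfold inO; omega)
        (by unfold inO; omega) (by omega) (by omega) <;>
      · unfold inO; split_ifs <;> omega
    · apply mk 1 3 (by omega) (by omega) (by omega) (by unfold inO; omega)
        (by unfold inO; omega) (by omega) (by omega) <;>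
      · unfold inO; split_ifs <;> omega
    · apply mk 1 2 (by omega) (by omega) (by omega) (by unfold inO; omega)
        (by unfold inO; omega) (by omega) (by omega) <;>
      · unfold inO; split_ifs <;> omega
    · apply mk 2 3 (by omega) (by omega) (by omega) (by unfold inO; omega)
        (by unfold inO; omega) (by omega) (by omega) <;>
      · unfold inO; split_ifs <;> omega
    · apply mk 1 3 (by omega) (by omega) (by omega) (by unfold inO; omega)
        (by unfold inO; omega) (by omega) (by omega) <;>
      · unfold inO; split_ifs <;> omega
  · -- d ∈ [n+4, 2n]
    by_cases e : d = 2 * n - 2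
    · apply mk (n + 3) (n - 2) (by omega) (by omega) (by omega) (by unfold inO; omega)
        (by unfold inO; omega) (by omega) (by omega) <;>
      · unfold inO; split_ifs <;> omega
    · apply mk (n + 3) n (by omega) (by omega) (by omega) (by unfold inO; omega)
        (by unfold inO; omega) (by omega) (by omega) <;>
      · unfold inO; split_ifs <;> omega

/-- `inO n 0` is false. -/
theorem not_inO_zero {n : ℕ} (hn : 5 ≤ n) : ¬ inO n 0 := by unfold inO; omega

/-- **The cyclic family is a local strong USP** for every `n ≥ 5`. -/
theorem cycRow_isLocalStrongUSP {n : ℕ} (hn : 5 ≤ n) : IsLocalStrongUSP (cycRow n) := by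
  intro a b c hne
  by_cases hac : a = c
  · subst hac
    have hba : b ≠ a := by
      rcases hne with h | h
      · exact fun e => h e.symm
      · exact h
    refine ⟨b, ?_⟩
    have hbb : cycRow n b b = 1 := by simp [cycRow]
    have hab : cycRow n a b = 0 ∨ cycRow n a b = 2 := by
      unfold cycRow; rw [if_neg hba]; split_ifs <;> simp
    rw [hbb, mem_localStrongUSPPatterns_iff]
    rcases hab with h | h <;> rw [h] <;> decide
  · have hδ : c - a ≠ 0 := sub_ne_zero.mpr (Ne.symm hac)
    obtain ⟨o₁, o₂, h12, ho1, ho2, hd1, hd2, hn1, hn2⟩ := cyc_witness hn (c - a) hδ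
    have key : ∀ o : Fin (2 * n + 1), inO n o.val → o ≠ c - a → ¬ inO n (o - (c - a)).val →
        a + o ≠ b →
        (cycRow n a (a + o), cycRow n b (a + o), cycRow n c (a + o)) ∈ localStrongUSPPatterns := by
      intro o ho hoδ hno htb
      have h0 : cycRow n a (a + o) = 0 := by
        have hne' : a + o ≠ a := by
          intro e
          have ho0 : o = 0 := by simpa using e
          rw [ho0, Fin.val_zero] at ho
          exact not_inO_zero hn ho
        unfold cycRow
        rw [if_neg hne', add_sub_cancel_left, if_pos ho]
      have h2 : cycRow n c (a + o) = 2 := by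
        have hne' : a + o ≠ c := by
          intro e; apply hoδ; rw [← e]; abel
        unfold cycRow
        rw [if_neg hne', show a + o - c = o - (c - a) by abel, if_neg hno]
      have h1 : cycRow n b (a + o) ≠ 1 := by
        unfold cycRow; rw [if_neg htb]; split_ifs <;> decide
      rw [h0, h2, mem_localStrongUSPPatterns_iff]
      exact Or.inr (Or.inl ⟨rfl, h1, rfl⟩)
    by_cases hb : a + o₁ = b
    · refine ⟨a + o₂, key o₂ ho2 hd2 hn2 ?_⟩
      intro e
      exact h12 (add_left_cancel (hb.trans e.symm))
    · exact ⟨a + o₁, key o₁ ho1 hd1 hn1 hb⟩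

/-! ### Counting the symbols of a row -/

/-- Row `a` carries a `1` (coded `0`) at `t` iff `t - a ∈ O`. -/
theorem cycRow_eq_zero_iff {n : ℕ} (hn : 5 ≤ n) (a t : Fin (2 * n + 1)) :
    cycRow n a t = 0 ↔ inO n (t - a).val := by
  unfold cycRow
  split_ifs with h1 h2
  · subst h1
    simp only [sub_self, Fin.val_zero, not_inO_zero hn, iff_false]
    decide
  · simp [h2]
  · simp only [h2, iff_false]
    decide

/-- Row `a` carries its `2` (coded `1`) exactly at `t = a`. -/
theorem cycRow_eq_one_iff {n : ℕ} (a t : Fin (2 * n + 1)) : cycRow n a t = 1 ↔ t = a := by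
  unfold cycRow
  split_ifs with h1 h2
  · simp [h1]
  · simp only [h1, iff_false]; decide
  · simp only [h1, iff_false]; decide

/-- `|O| = n` inside `Fin (2n+1)`. -/
theorem card_inO {n : ℕ} (hn : 5 ≤ n) :
    (Finset.univ.filter fun x : Fin (2 * n + 1) => inO n x.val).card = n := by
  have h : (Finset.univ.filter fun x : Fin (2 * n + 1) => inO n x.val).map Fin.valEmbedding =
      (Finset.range (2 * n + 1)).filter (inO n) := by
    ext m
    simp only [Finset.mem_map, Finset.mem_filter, Finset.mem_univ, true_and, Fin.valEmbedding_apply,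
      Finset.mem_range]
    constructor
    · rintro ⟨x, hx, rfl⟩; exact ⟨x.isLt, hx⟩
    · rintro ⟨hm, hx⟩; exact ⟨⟨m, hm⟩, hx, rfl⟩
  rw [← Finset.card_map Fin.valEmbedding, h]
  have h2 : (Finset.range (2 * n + 1)).filter (inO n) = Finset.Icc 1 (n - 2) ∪ {n, n + 3} := by
    ext m
    simp only [Finset.mem_filter, Finset.mem_range, Finset.mem_union, Finset.mem_Icc, Finset.mem_insert,
      Finset.mem_singleton, inO]
    omega
  rw [h2, Finset.card_union_of_disjoint, Nat.card_Icc, Finset.card_pair (by omega)]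
  · omega
  · rw [Finset.disjoint_left]
    intro m hm hm'
    simp only [Finset.mem_Icc] at hm
    simp only [Finset.mem_insert, Finset.mem_singleton] at hm'
    omega

/-- Each row has `n` ones. -/
theorem card_cycRow_zero {n : ℕ} (hn : 5 ≤ n) (a : Fin (2 * n + 1)) :
    (Finset.univ.filter fun t => cycRow n a t = 0).card = n := by
  have h1 : (Finset.univ.filter fun t => cycRow n a t = 0) =
      (Finset.univ.filter fun x : Fin (2 * n + 1) => inO n x.val).map (Equiv.addRight a).toEmbedding := by
    ext t
    simp only [Finset.mem_filter, Finset.mem_univ, true_and, Finset.mem_map_equiv,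
      cycRow_eq_zero_iff hn, Equiv.addRight_symm, Equiv.coe_addRight, ← sub_eq_add_neg]
  rw [h1, Finset.card_map, card_inO hn]

/-- Each row has one `2`. -/
theorem card_cycRow_one {n : ℕ} (a : Fin (2 * n + 1)) :
    (Finset.univ.filter fun t => cycRow n a t = 1).card = 1 := by
  rw [Finset.card_eq_one]
  exact ⟨a, by ext t; simp [cycRow_eq_one_iff]⟩

/-- Each row has `n` threes. -/
theorem card_cycRow_two {n : ℕ} (hn : 5 ≤ n) (a : Fin (2 * n + 1)) :
    (Finset.univ.filter fun t => cycRow n a t = 2).card = n := by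
  have hsplit : (Finset.univ : Finset (Fin (2 * n + 1))) =
      ((Finset.univ.filter fun t => cycRow n a t = 0) ∪ (Finset.univ.filter fun t => cycRow n a t = 1)) ∪
        (Finset.univ.filter fun t => cycRow n a t = 2) := by
    ext t
    simp only [Finset.mem_univ, Finset.mem_union, Finset.mem_filter, true_and, true_iff]
    have h3 : ∀ x : Fin 3, x = 0 ∨ x = 1 ∨ x = 2 := by decide
    rcases h3 (cycRow n a t) with h | h | h <;> simp [h]
  have hd01 : Disjoint (Finset.univ.filter fun t => cycRow n a t = 0)
      (Finset.univ.filter fun t => cycRow n a t = 1) := by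
    rw [Finset.disjoint_filter]; intro t _ h; rw [h]; decide
  have hd2 : Disjoint ((Finset.univ.filter fun t => cycRow n a t = 0) ∪
      (Finset.univ.filter fun t => cycRow n a t = 1)) (Finset.univ.filter fun t => cycRow n a t = 2) := by
    rw [Finset.disjoint_union_left, Finset.disjoint_filter, Finset.disjoint_filter]
    exact ⟨fun t _ h => by rw [h]; decide, fun t _ h => by rw [h]; decide⟩
  have := congrArg Finset.card hsplit
  rw [Finset.card_union_of_disjoint hd2, Finset.card_union_of_disjoint hd01, card_cycRow_zero hn,
    card_cycRow_one, Finset.card_univ, Fintype.card_fin] at this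
  omega

end Summit.MatrixMultiplication.MatrixMultiplication.Theorems.RectangularThmB.Negative
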